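import Literature.Topology.FourManifolds.TautFoliationsVertexStar
import Literature.Topology.FourManifolds.TautFoliationsConePunctures
import Literature.Topology.PlanarFoliations.StarPunctures
import Literature.Topology.PlanarFoliations.ProngStarRestrict
import HarnessLib

/-!
# The star data of a disc in checkerboard cone position

Topic: sequel to `TautFoliationsConePunctures.lean` (the puncture data of the contour foliation
of a disc in checkerboard cone position) and `TautFoliationsVertexStar.lean` (the four-prong
star at a grid vertex). We package the contour foliation of a disc in checkerboard cone position
as **star data** (`Literature.Topology.PlanarFoliations.StarData`), the abstract setting of the
planar part of Novikov's theorem (`EssentialLeafVanishing.lean`):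

* `ConePosition.boxOf`, `ConePosition.punctureData'` (**definitions**): the puncture data with
  explicit flow boxes — the box of the base square `q₀` at a vertex, the box of the square at a
  centre — so that the level at a vertex is the common height `Hv` of the vertex star up to a
  constant;
* `ConePosition.starData` (**definition**, all fields **proved**): four prongs at the vertex
  punctures (the vertex star shrunk into the puncture ball, `ProngStar.exists_restrict_subset`),
  none at the centres (`height_ne_of_mem_centres`), level compatibility by construction.

## References

* C. Camacho, A. Lins Neto, *Geometric Theory of Foliations*, Birkhäuser (1985), Ch. VI §2,
  Ch. VII §2 [CamachoLinsNeto1985].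
-/

noncomputable section

open Set Filter Metric Topology Function
open Literature.Topology.PlanarFoliations

namespace Literature.Topology.FourManifolds

namespace Foliation.ConePosition

open ConeSquare SquareGrid VertexSector

variable {B : Type*} [NormedAddCommGroup B] [NormedSpace ℝ B] {M : Type*} [TopologicalSpace M]
  {F : Foliation B M} {f : ℝ × ℝ → M} {c₀ : ℝ × ℝ} {L : ℝ} {hL : 0 < L} (P : ConePosition F f c₀ hL)
  (ho : F.IsTransverselyOriented)

/-! ## Vertex punctures -/

/-- **The vertex condition**: the point is a grid vertex inside the big ball. [folklore] -/
def IsVtx (v : ℂ) : Prop := toR v ∈ P.gr.vertices ∧ toR v ∈ ball P.gr.bigCentre (P.gr.n * P.gr.ℓ)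

omit [NormedSpace ℝ B] in
/-- A vertex puncture is a puncture. [folklore] -/
theorem mem_punct_of_isVtx {v : ℂ} (h : P.IsVtx v) : v ∈ P.punct :=
  (P.mem_punct_iff).2 ⟨Or.inr h.1, h.2⟩

omit [NormedSpace ℝ B] in
/-- A puncture which is not a vertex puncture is a centre. [folklore] -/
theorem exists_centre_of_not_isVtx {v : ℂ} (hv : v ∈ P.punct) (h : ¬ P.IsVtx v) : ∃ q, toR v = P.gr.centre q := by
  obtain ⟨hvP, hvb⟩ := (P.mem_punct_iff).1 hv
  rcases hvP with ⟨q, hq⟩ | hvV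
  · exact ⟨q, hq.symm⟩
  · exact absurd ⟨hvV, hvb⟩ h

/-! ## Explicit flow boxes at the punctures -/

/-- **The flow box at a point of the plane**: at a vertex puncture the box of the base square of
the vertex star, at a centre the box of its square. [folklore] -/
def boxOf (v : ℂ) : OpenPartialHomeomorph M (B × ℝ) := by
  classical
  exact if h : P.IsVtx v then P.box (P.q₀ h.1 h.2)
    else if h' : ∃ q, toR v = P.gr.centre q then P.box h'.choose else P.box (⟨0, P.hn⟩, ⟨0, P.hn⟩)

omit [NormedSpace ℝ B] in
/-- The flow box at a vertex puncture. [folklore] -/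
theorem boxOf_of_isVtx {v : ℂ} (h : P.IsVtx v) : P.boxOf v = P.box (P.q₀ h.1 h.2) := by
  classical
  unfold boxOf; rw [dif_pos h]

omit [NormedSpace ℝ B] in
/-- The flow boxes belong to the atlas. [folklore] -/
theorem boxOf_mem (v : ℂ) : P.boxOf v ∈ F.atlas := by
  classical
  unfold boxOf
  split_ifs <;> exact P.box_mem _

/-- **The local data at a puncture, in the explicit box.** [folklore] -/
theorem exists_localData' (v : ℂ) (hv : v ∈ P.punct) : ∃ (r : ℝ) (S : Set P.gr.X₀),
    0 < r ∧ r ≤ P.gr.ℓ / 2 ∧ ball v r ⊆ P.Ω ∧ (∀ v' ∈ P.punct, v' ∈ ball v r → v' = v) ∧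
    MapsTo P.fillC (ball v r) (P.boxOf v).source ∧ S.Finite ∧
    ∀ y : P.gr.X₀, P.gr.planeEmb y ∈ ball v r → (P.boxOf v (P.fillC (P.gr.planeEmb y))).2 = (P.boxOf v (P.fillC v)).2 →
      ∃ s ∈ S, y ∈ (P.contourFol ho).leaf s := by
  classical
  have hℓ := P.gr.hℓ
  obtain ⟨hvP, hvb⟩ := (P.mem_punct_iff).1 hv
  set gap := P.gr.n * P.gr.ℓ - dist (toR v) P.gr.bigCentre with hgap
  have hgappos : 0 < gap := by have := mem_ball.1 hvb; linarith
  have hcommon : ∀ {r : ℝ}, r ≤ min (P.gr.ℓ / 2) gap →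
      ball v r ⊆ P.Ω ∧ (∀ v' ∈ P.punct, v' ∈ ball v r → v' = v) := by
    intro r hr
    have hr₁ : r ≤ P.gr.ℓ / 2 := hr.trans (min_le_left _ _)
    have hr₂ : r ≤ gap := hr.trans (min_le_right _ _)
    constructor
    · intro z hz
      rw [mem_Ω_iff, mem_ball]
      have h := (dist_toR_le z v).trans_lt (mem_ball.1 hz)
      calc dist (toR z) P.gr.bigCentre ≤ dist (toR z) (toR v) + dist (toR v) P.gr.bigCentre := dist_triangle _ _ _
        _ < P.gr.n * P.gr.ℓ := by linarith
    · intro v' hv' hv'b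
      by_contra hne
      have hne' : toR v' ≠ toR v := fun h ↦ hne (toR_injective h)
      have h := P.gr.le_dist_of_mem_punct ((P.mem_punct_iff).1 hv').1 hvP hne'
      have h' := (dist_toR_le v' v).trans_lt (mem_ball.1 hv'b)
      linarith
  by_cases hV : P.IsVtx v
  · -- a vertex: the box of the base square
    have hvV := hV.1
    rw [P.boxOf_of_isVtx hV]
    have hq₀ : P.gr.centre (P.q₀ hV.1 hV.2) = ((toR v).1 + 1 * P.gr.ℓ, (toR v).2 + 1 * P.gr.ℓ) := by
      show P.gr.centre (P.qU hV.1 hV.2 0) = _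
      rw [P.centre_qU hV.1 hV.2 0, cU, Rz_zero, one_mul]; rfl
    have hvq₀ : toR v ∈ P.gr.sq (P.q₀ hV.1 hV.2) := P.mem_sq_qU hV.1 hV.2 0
    obtain ⟨r₁, hr₁pos, hr₁ℓ, S, hSfin, hS⟩ := P.exists_cover_vertex ho hvV hvb hq₀
    set r := min r₁ (min (P.gr.ℓ / 2) gap) with hr
    have hrpos : 0 < r := lt_min hr₁pos (lt_min (by linarith) hgappos)
    obtain ⟨hball, huniq⟩ := hcommon (r := r) (min_le_right _ _)
    refine ⟨r, S, hrpos, (min_le_right _ _).trans (min_le_left _ _), hball, huniq, fun z hz ↦ ?_, hSfin, fun y hy hlev ↦ ?_⟩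
    · have hd : dist (toR z) (toR v) < P.gr.ℓ := by
        have := (dist_toR_le z v).trans_lt (mem_ball.1 hz)
        linarith [min_le_right r₁ (min (P.gr.ℓ / 2) gap), min_le_left (P.gr.ℓ / 2) gap]
      obtain ⟨q', hzq', hvq'⟩ := P.exists_sq_of_dist_lt_vertex hvV hvb hd
      exact P.fill_mem_source_of_adj P.apex_spec.1 (P.gr.adj_of_inter_nonempty ⟨toR v, hvq', hvq₀⟩) hzq'
    · have hd : dist (y : ℝ × ℝ) (toR v) < r₁ := by
        rw [← P.toR_planeEmb y]
        exact ((dist_toR_le _ v).trans_lt (mem_ball.1 hy)).trans_le (min_le_left _ _)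
      refine hS y hd ?_
      simpa [fillC, toR_planeEmb, height] using hlev
  · -- a centre: the box of its square
    obtain ⟨q, hq⟩ := P.exists_centre_of_not_isVtx hv hV
    have hex : ∃ q, toR v = P.gr.centre q := ⟨q, hq⟩
    have hbox : P.boxOf v = P.box hex.choose := by unfold boxOf; rw [dif_neg hV, dif_pos hex]
    have hq' : toR v = P.gr.centre hex.choose := hex.choose_spec
    rw [hbox]
    set q₁ := hex.choose with hq₁def
    clear_value q₁
    set r := min (P.gr.ℓ / 2) gap with hr
    have hrpos : 0 < r := lt_min (by linarith) hgappos
    obtain ⟨hball, huniq⟩ := hcommon (r := r) le_rfl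
    refine ⟨r, ∅, hrpos, min_le_left _ _, hball, huniq, fun z hz ↦ ?_, finite_empty, fun y hy hlev ↦ ?_⟩
    · have hd : dist (toR z) (P.gr.centre q₁) < P.gr.ℓ := by
        rw [← hq']; have := (dist_toR_le z v).trans_lt (mem_ball.1 hz); linarith [min_le_left (P.gr.ℓ / 2) gap]
      exact P.fill_mem_source P.apex_spec.1 (P.mem_sq_of_dist_lt hd)
    · exfalso
      have hd : dist (y : ℝ × ℝ) (P.gr.centre q₁) < P.gr.ℓ := by
        rw [← hq', ← P.toR_planeEmb y]
        have := (dist_toR_le _ v).trans_lt (mem_ball.1 hy); linarith [min_le_left (P.gr.ℓ / 2) gap]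
      refine P.height_ne_of_mem_centres q₁ y hd ?_
      have h : toR v = P.gr.centre q₁ := hq'
      simpa [fillC, toR_planeEmb, h, height] using hlev

/-- **The radius at a point of the plane**: the radius of the local data at a puncture. [folklore] -/
def radOf (v : ℂ) : ℝ := by
  classical
  exact if hv : v ∈ P.punct then (P.exists_localData' ho v hv).choose else 1

/-- The properties of the radius at a puncture. [folklore] -/
theorem radOf_spec {v : ℂ} (hv : v ∈ P.punct) : ∃ S : Set P.gr.X₀,
    0 < P.radOf ho v ∧ P.radOf ho v ≤ P.gr.ℓ / 2 ∧ ball v (P.radOf ho v) ⊆ P.Ω ∧ (∀ v' ∈ P.punct, v' ∈ ball v (P.radOf ho v) → v' = v) ∧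
    MapsTo P.fillC (ball v (P.radOf ho v)) (P.boxOf v).source ∧ S.Finite ∧
    ∀ y : P.gr.X₀, P.gr.planeEmb y ∈ ball v (P.radOf ho v) → (P.boxOf v (P.fillC (P.gr.planeEmb y))).2 = (P.boxOf v (P.fillC v)).2 →
      ∃ s ∈ S, y ∈ (P.contourFol ho).leaf s := by
  classical
  unfold radOf
  rw [dif_pos hv]
  exact (P.exists_localData' ho v hv).choose_spec

/-- The radius at a puncture is at most half the mesh. [folklore] -/
theorem radOf_le {v : ℂ} (hv : v ∈ P.punct) : P.radOf ho v ≤ P.gr.ℓ / 2 := (P.radOf_spec ho hv).choose_spec.2.1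

/-- **The puncture data of a disc in checkerboard cone position, with explicit boxes.**
[folklore] -/
def punctureData' : PunctureData (P.contourFol ho) P.gr.planeEmb F P.fillC where
  Ω := P.Ω
  isOpen_Ω := isOpen_ball.preimage continuous_toR
  P := P.punct
  P_finite := ((P.gr.finite_centres.union P.gr.finite_vertices).preimage toR_injective.injOn).subset inter_subset_left
  P_subset := inter_subset_right
  range_eq := (P.punctureData ho).range_eq
  continuousOn := (P.punctureData ho).continuousOn
  foliated := (P.punctureData ho).foliated
  box := P.boxOf
  box_mem v _ := P.boxOf_mem v
  rad := P.radOf ho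
  rad_pos _ hv := (P.radOf_spec ho hv).choose_spec.1
  ball_subset _ hv := (P.radOf_spec ho hv).choose_spec.2.2.1
  eq_of_mem_ball _ hv := (P.radOf_spec ho hv).choose_spec.2.2.2.1
  mapsTo_ball _ hv := (P.radOf_spec ho hv).choose_spec.2.2.2.2.1
  finite_level _ hv := ⟨_, (P.radOf_spec ho hv).choose_spec.2.2.2.2.2.1, (P.radOf_spec ho hv).choose_spec.2.2.2.2.2.2⟩

/-- The boxes of the explicit puncture data. [folklore] -/
@[simp] theorem punctureData'_box : (P.punctureData' ho).box = P.boxOf := rfl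

/-- The punctures of the explicit puncture data. [folklore] -/
@[simp] theorem punctureData'_P : (P.punctureData' ho).P = P.punct := rfl

/-- The region of the explicit puncture data. [folklore] -/
@[simp] theorem punctureData'_Ω : (P.punctureData' ho).Ω = P.Ω := rfl

/-- The radii of the explicit puncture data. [folklore] -/
@[simp] theorem punctureData'_rad : (P.punctureData' ho).rad = P.radOf ho := rfl

/-! ## The stars at the vertex punctures -/

/-- **A good radius for the vertex star**: shrunk to it, the sectors lie in the puncture ball.
[folklore] -/
theorem exists_goodRadius {v : ℂ} (h : P.IsVtx v) : ∃ ρ', ∃ (hρ' : 0 < ρ') (hle : ρ' ≤ (P.vertexStar h.1 h.2 ho).ρ),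
    ∀ j, ((P.vertexStar h.1 h.2 ho).restrict hρ' hle).S j ⊆ ball v ((P.punctureData' ho).rad v) :=
  (P.vertexStar h.1 h.2 ho).exists_restrict_subset
    (Metric.ball_mem_nhds v ((P.punctureData' ho).rad_pos v (P.mem_punct_of_isVtx h)))

/-- **The star at a vertex puncture**: the vertex star shrunk into the puncture ball. [folklore] -/
def vtxStar {v : ℂ} (h : P.IsVtx v) : ProngStar (P.contourFol ho) P.gr.planeEmb v 4 :=
  (P.vertexStar h.1 h.2 ho).restrict (P.exists_goodRadius ho h).choose_spec.choose
    (P.exists_goodRadius ho h).choose_spec.choose_spec.choose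

/-- The sectors of the star at a vertex puncture lie in the puncture ball. [folklore] -/
theorem vtxStar_S_subset {v : ℂ} (h : P.IsVtx v) (j : ZMod 4) : (P.vtxStar ho h).S j ⊆ ball v ((P.punctureData' ho).rad v) :=
  (P.exists_goodRadius ho h).choose_spec.choose_spec.choose_spec j

/-- The height of the star at a vertex puncture is the common height. [folklore] -/
theorem vtxStar_H {v : ℂ} (h : P.IsVtx v) (z : ℂ) : (P.vtxStar ho h).H z = P.Hv h.1 h.2 (toR z) := by
  unfold vtxStar; rw [ProngStar.restrict_H, vertexStar_H]

/-- **The number of prongs and the star**, packaged: four prongs at a vertex puncture, none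
elsewhere. [folklore] -/
def starSigma (v : ℂ) : Σ n : ℕ, PLift (n ≠ 0 → ProngStar (P.contourFol ho) P.gr.planeEmb v n) := by
  classical
  exact if h : P.IsVtx v then ⟨4, ⟨fun _ ↦ P.vtxStar ho h⟩⟩ else ⟨0, ⟨fun hn ↦ absurd rfl hn⟩⟩

/-- The package at a vertex puncture. [folklore] -/
theorem starSigma_of_isVtx {v : ℂ} (h : P.IsVtx v) : P.starSigma ho v = ⟨4, ⟨fun _ ↦ P.vtxStar ho h⟩⟩ := by
  classical
  unfold starSigma; rw [dif_pos h]

/-- The package off the vertex punctures. [folklore] -/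
theorem starSigma_fst_of_not_isVtx {v : ℂ} (h : ¬ P.IsVtx v) : (P.starSigma ho v).1 = 0 := by
  classical
  unfold starSigma; rw [dif_neg h]

/-- A nonzero number of prongs forces a vertex puncture. [folklore] -/
theorem isVtx_of_fst_ne_zero {v : ℂ} (h : (P.starSigma ho v).1 ≠ 0) : P.IsVtx v := by
  by_contra hV; exact h (P.starSigma_fst_of_not_isVtx ho hV)

/-- **The star data of a disc in checkerboard cone position.** [cite: CamachoLinsNeto1985, Ch. VII §2] -/
def starData : StarData (P.contourFol ho) P.gr.planeEmb F P.fillC where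
  toPunctureData := P.punctureData' ho
  nprong v := (P.starSigma ho v).1
  star v h := (P.starSigma ho v).2.down h
  mem_P v h := P.mem_punct_of_isVtx (P.isVtx_of_fst_ne_zero ho h)
  centre v hv h0 y hy := by
    classical
    have hV : ¬ P.IsVtx v := fun hV ↦ by
      have := congrArg Sigma.fst (P.starSigma_of_isVtx ho hV)
      exact four_ne_zero (this.symm.trans h0)
    have hv' : v ∈ P.punct := hv
    obtain ⟨q, hq⟩ := P.exists_centre_of_not_isVtx hv' hV
    have hex : ∃ q, toR v = P.gr.centre q := ⟨q, hq⟩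
    have hbox : P.boxOf v = P.box hex.choose := by unfold boxOf; rw [dif_neg hV, dif_pos hex]
    have hq' : toR v = P.gr.centre hex.choose := hex.choose_spec
    set q₁ := hex.choose with hq₁def
    clear_value q₁
    have hy' : P.gr.planeEmb y ∈ ball v (P.radOf ho v) := hy
    have hd : dist (y : ℝ × ℝ) (P.gr.centre q₁) < P.gr.ℓ := by
      rw [← hq', ← P.toR_planeEmb y]
      have := (dist_toR_le _ v).trans_lt (mem_ball.1 hy')
      linarith [P.radOf_le ho hv', P.gr.hℓ]
    show (P.boxOf v (P.fillC (P.gr.planeEmb y))).2 ≠ (P.boxOf v (P.fillC v)).2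
    rw [hbox]
    intro hlev
    refine P.height_ne_of_mem_centres q₁ y hd ?_
    have h : toR v = P.gr.centre q₁ := hq'
    simpa [fillC, toR_planeEmb, h, height] using hlev
  S_subset_ball v h j := by
    have hV := P.isVtx_of_fst_ne_zero ho h
    have key : ∀ (σ : Σ n : ℕ, PLift (n ≠ 0 → ProngStar (P.contourFol ho) P.gr.planeEmb v n))
        (e : σ = ⟨4, ⟨fun _ ↦ P.vtxStar ho hV⟩⟩) (h' : σ.1 ≠ 0) (j' : ZMod σ.1),
        (σ.2.down h').S j' ⊆ ball v ((P.punctureData' ho).rad v) := by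
      rintro σ rfl h' j'
      exact P.vtxStar_S_subset ho hV j'
    exact key _ (P.starSigma_of_isVtx ho hV) h j
  level_lt_iff v h i j z hz z' hz' := by
    have hV := P.isVtx_of_fst_ne_zero ho h
    have key : ∀ (σ : Σ n : ℕ, PLift (n ≠ 0 → ProngStar (P.contourFol ho) P.gr.planeEmb v n))
        (e : σ = ⟨4, ⟨fun _ ↦ P.vtxStar ho hV⟩⟩) (h' : σ.1 ≠ 0) (z z' : ℂ),
        (σ.2.down h').H z < (σ.2.down h').H z' ↔ P.Hv hV.1 hV.2 (toR z) < P.Hv hV.1 hV.2 (toR z') := by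
      rintro σ rfl h' z z'
      rw [P.vtxStar_H ho hV, P.vtxStar_H ho hV]
    rw [key _ (P.starSigma_of_isVtx ho hV) h z z']
    show (P.boxOf v (P.fillC z)).2 < (P.boxOf v (P.fillC z')).2 ↔ _
    rw [P.boxOf_of_isVtx hV, Hv, Hv, sub_lt_sub_iff_right]
    rfl

end Foliation.ConePosition

end Literature.Topology.FourManifolds
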